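import Summits.BirchSwinnertonDyer.BirchSwinnertonDyer.Theorems.EisensteinPrimesMazurMCOnX1RankZeroLocate
import Summits.BirchSwinnertonDyer.Rank1Residual.X1.MuPart
import Literature.NumberTheory.EllipticCurves.Rank1Residual.ClassX1Isogeny
import Literature.NumberTheory.EllipticCurves.KatoRankBoundProofs
import Literature.NumberTheory.EllipticCurves.IwasawaSelmerDualProofs
import HarnessLib

/-!
# Crux `MazurMCOnX1RankZero` (stmt-BirchSwinnertonDyer-19035), line `mudescent`, stub
# `stub_analyticMuZero_offLocus`: the Greenberg–Vatsal road re-aimed at the off-locus member —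
# what the kernel can say (cell `bsd-eis`, seat `bsd-eis-mu-b`, PROGRAMME PART 1b seat (2);
# CONSTRUCTION seat, open-problem grade — this file closes NO stub)

The open stub of line `mudescent` (ky g7, skeleton `d113fc0a…`) reads
`ClassX1 W₀ p → W₀.analyticRank = 0 → ¬ HasRamifiedOddLineAt W₀ p → X1.MuPart.AnalyticMuLE W₀ p 0`:
at the «étale end» `W₀` of a rank-`0` X1 isogeny class (good anomalous Eisenstein `p > 2`, type A =
`¬ GVPar`) some coefficient of the Néron-normalised Mazur–Swinnerton-Dyer `p`-adic `L`-function
`ϖ·L_p(f,α)` is a `p`-adic unit («`μ_an(W₀) = 0`»). The seat's brief: «Greenberg–Vatsal 2000 Thm. 1.3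
(ramified-even / unramified-odd kernel ⇒ `μ_an = 0`) matched to `¬ HasRamifiedOddLineAt W₀`».

WHAT IS PRINTED (verbatim; arXiv:math/9906215 = Invent. Math. 142 (2000)). Thm. (1.3): «Assume also
that `E` admits a ℚ-isogeny of degree `p` with kernel `Φ`, and that the action of `G_ℚ` on `Φ` is either
ramified at `p` and even, or unramified at `p` and odd. Then `λ^alg_E = λ^anal_E` and
`μ^alg_E = μ^anal_E = 0`.» (the tree's `GVPar`, hypothesis of the facts
`GreenbergVatsal2000.thm13_charIdeal_eq_of_gvPar` and `Greenberg1999.prop510_isTorsion_hasUnitContent_of_gvPar`;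
on the tree the implication «GV parity ⇒ `AnalyticMuLE W p 0`» is
`SlopeDichotomyA2DegenerateLocusA2RegulatorFloorPub.analyticMuLE_zero_of_gvPar`). p. 5: «Unfortunately,
if `E` is a quadratic twist of `J` by an even character, we can prove very little.» Its analytic
engine Thm. (3.12) reads the branch of sign `−ψ(−1)`, `ψ` the UNRAMIFIED character (GV pp. 32–33,
«admissible» sign, after [Vat97] Thms. 1.3/2.7): on type A `ψ` is even, the admissible branch is the
ODD one, and the cyclotomic `L_p(E,T)` is the even branch. Greenberg, LNM 1716: Prop. 5.7 (ramified-odd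
cyclic subgroup of order `p^m` ⇒ `μ ≥ m`), Conj. 1.11 («there exists a ℚ-isogenous elliptic curve `E′`
such that `μ_{E′} = 0`»); on the type-3-even locus of A. Ray, arXiv:2308.06673 §6 («lower triangular
… `φ₂` even») `μ = 0` «was expected … however, not proved»; Trifković, CJM 57 (2005), Conj. 2 (the
`0 → ℤ/p → E[p] → μ_p → 0` non-split case) with criterion-type Thms. 3–4 at `p = 3, 5`; Pollack–Wake,
Tunisian J. Math. 7 (2025) Thm. 5.12 (exact analytic `μ` at PRIME level, `p ≥ 5`; §1.5: «`X_0(11)` is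
the only elliptic curve we know of for which Theorem 1.2 applies»).

WHAT THIS FILE PROVES (theorems only; no `def`, no named fact, no `sorry`; every input a tree
theorem or a PUBLISHED named fact taken as displayed hypothesis — Greenberg Prop. 5.7 `h57`, Wuthrich
2014 Thm. 16 `hW16`, modularity `hmod`):
* §1 THE HYPOTHESIS OF THE STUB IS NECESSARY (analytic twin of the barrier `EisensteinMuBarrier`, not
  previously on the tree): at a leaf member CARRYING a ramified rational `p`-line the certificate
  `AnalyticMuLE W p 0` is FALSE (`not_analyticMuLE_zero_of_leaf_of_ramified_line`: Prop. 5.7 ⇒ `p ∣ g`,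
  Thm. 16 ⇒ `ϖ·L_p = ι(g·h)`, so every coefficient has norm `≤ p⁻¹`; modularity supplies the newform at
  which the certificate is read). Hence on the leaf `AnalyticMuLE W p 0` forces EVERY rational line to
  be unramified ∧ even (`forall_lineUnramifiedAt_and_lineEven_of_leaf_of_analyticMuLE_zero`) and
  `¬ HasRamifiedOddLineAt W p` (`not_hasRamifiedOddLineAt_of_leaf_of_analyticMuLE_zero`): in a leaf
  class the `μ_an = 0` members are AMONG the off-locus members; the stub asserts the converse
  inclusion. The dichotomy `analyticMu_dichotomy_of_leaf` packages it.
* §2 WHY A «Thm. (1.3)-TYPE» ARGUMENT CANNOT REACH THE STUB (kernel form of the obstruction): GV's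
  hypothesis is EXISTENTIAL in one line («admits a ℚ-isogeny … with kernel `Φ`» of prescribed type). On
  the leaf NO member of the isogeny class satisfies it (`not_gvPar_of_isIsogenous_of_leaf`: the leaf is
  isogeny-closed), and the existential statement of the remaining («fourth-cell») type — «some rational
  line is unramified ∧ even ⇒ `μ_an = 0`» — is FALSE on the leaf as soon as a member carries an
  unramified line AND a ramified one (`not_existsForm_of_leaf_of_unramified_of_ramified`; printed
  witness `X_0(11)` at `5`: `E[5] ⊇ ℤ/5 ⊕ μ_5`, `μ = 1`, Greenberg LNM 1716 §1 p. 58 / §5). The only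
  correct hypothesis is UNIVERSAL in the lines («every rational line unramified», the output of the
  landed `stub_locate`), i.e. a condition on the position of the member in the `p`-isogeny graph, which
  the inputs of GV's proof (the characters `φ, ψ` of `E[p]^{ss}`, one line, Kato, Ferrero–Washington)
  do not see; `stub_iff_forall_lineUnramifiedAt_form` records that the registered hypothesis and the
  universal form agree on the leaf.
* §3 CALIBRATION — THE STUB IS AT LEAST GREENBERG'S CONJECTURE 1.11 ON THE LEAF: granted `hW16` and
  `hmod`, the stub implies, for EVERY rank-`0` X1 pair `(E,p)`, a `ℚ`-isogenous `E₀` (the off-locus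
  member of `stub_locate`) with `X(E₀/ℚ_∞)` `Λ`-torsion and `μ(X(E₀/ℚ_∞)) = 0` for every cyclotomic dual
  datum (`greenbergMu_onLeaf_of_stub`) — verbatim the conclusion of LNM 1716 Conj. 1.11 for these
  classes (cf. the typing layer's staged `GreenbergMuConjecture`, same vocabulary), with the `μ = 0`
  member LOCATED. Pointwise: `mu_eq_zero_of_leaf_of_analyticMuLE_zero` (each census certificate at the
  `μ_an = 0` end is a kernel instance of Conj. 1.11 for its class). The converse (Conj. 1.11 ⇒ stub)
  would need the main conjecture itself (the crux) and is not claimed.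

HONEST FRAMING: nothing here proves or refutes `stub_analyticMuZero_offLocus`; §3 shows it is not
weaker than an open conjecture in print (restricted to the leaf), §§1–2 show that its hypothesis is
sharp and that no hypothesis of Greenberg–Vatsal's existential shape can replace it. No label or count
of the cell moves. References: [GreenbergVatsal2000] Thm. (1.3), (3.12), pp. 5, 32–33;
[GreenbergLNM1716] Prop. 5.7 (p. 113), Conj. 1.11 (p. 58), §5; [Wuthrich2014] Thm. 16;
[BCDTJAMS2001] Thm. A; [Trifkovic2005] Conj. 2, Thms. 3–4; [PollackWake2025] Thm. 5.12, §1.5;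
A. Ray, arXiv:2308.06673 §6; HOME `run/shared/lean/pub/bsd-eis/mu-b-MEMO-1.md`.
-/

set_option autoImplicit false

-- `Summit.BirchSwinnertonDyer.BirchSwinnertonDyer.…`: the summit and its single sub-problem share a name (D-0017 layout).
set_option linter.dupNamespace false

noncomputable section

open scoped Classical MatrixGroups ModularForm

open CongruenceSubgroup WeierstrassCurve
  Literature.NumberTheory.EllipticCurves Literature.NumberTheory.EllipticCurves.ModularForms
  Literature.NumberTheory.EllipticCurves.Rank1Residual
  Literature.NumberTheory.EllipticCurves.Greenberg1999
  Literature.Barriers.BirchSwinnertonDyer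
  Summit.BirchSwinnertonDyer.Rank1Residual
  Summit.BirchSwinnertonDyer.Rank1Residual.X1.MuPart
  Summit.BirchSwinnertonDyer.Rank1Residual.X1.MuStructure
  Summit.BirchSwinnertonDyer.BirchSwinnertonDyer.Theorems

namespace Summit.BirchSwinnertonDyer.BirchSwinnertonDyer.Theorems.EisensteinPrimesMazurMCOnX1RankZeroAnalyticMuOffLocus

variable {W : WeierstrassCurve ℚ} [W.IsElliptic] [W.IsGloballyMinimal] {p : ℕ} [hp : Fact p.Prime]

/-! ## §1 The off-locus hypothesis is necessary: `μ_an = 0` fails at every member carrying a ramified line -/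

/-- **The analytic certificate `μ_an = 0` is false ON the barrier locus of a leaf class.** For a leaf
pair `(E,p)` (X1 ∧ `r_an = 0`: `p > 2` good ordinary anomalous, `E[p]` reducible, type A) whose curve
carries a rational `p`-line `Φ` RAMIFIED at `p` (hence odd), granted Greenberg LNM 1716 Prop. 5.7
(`h57`), Wuthrich 2014 Thm. 16 (`hW16`) and modularity (`hmod`, to read the certificate at the newform
of `E`): `¬ AnalyticMuLE W p 0` — every coefficient of `ϖ·L_p(f,α)` has norm `< 1`, i.e. `≤ p⁻¹`
(`padicLFunction_coeff_norm_lt_one_of_leaf_of_ramified_line`), while the certificate asks for one of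
norm `> p⁻¹`. The analytic twin of `EisensteinMuBarrier.mu_ne_zero`. [cite: GreenbergLNM1716, Prop. 5.7 (p. 113)]
[cite: Wuthrich2014, Thm. 16 (p. 397)] [cite: BCDTJAMS2001, Theorem A] -/
theorem not_analyticMuLE_zero_of_leaf_of_ramified_line
    (h57 : prop57_one_le_mu_of_ramified_odd_line) (hW16 : Wuthrich2014.charIdeal_dvd_padicLFunction)
    (hmod : nonempty_modularParametrizationData) (hL : X1.RankZero.Leaf W p)
    {Φ : AddSubgroup (geomTorsion W (p : ℤ))} (hΦ : IsRationalLine W p Φ)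
    (hram : ¬ LineUnramifiedAt W p Φ) : ¬ AnalyticMuLE W p 0 := by
  intro han
  haveI : NeZero (W.conductorNorm ℤ) := ⟨(W.conductorNorm_pos_holds).ne'⟩
  obtain ⟨κ, hκ, γ, hγ, hγ'⟩ := exists_isCyclotomic_isTopGenerator_isCyclotomicVariable_holds p
  obtain ⟨D⟩ := W.nonempty_selmerDualData_holds κ γ hγ
  obtain ⟨Dm⟩ := hmod W
  obtain ⟨ϖ, -, hϖ, -⟩ := Dm.exists_rat_mul_realPeriodRat_eq_plusPeriod
  obtain ⟨n, hn⟩ := han Dm.f Dm.isNewformOf ϖ hϖ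
  have hlt := padicLFunction_coeff_norm_lt_one_of_leaf_of_ramified_line h57 hW16 hL hΦ hram hκ hγ hγ'
    Dm.isNewformOf hϖ D n
  have h1 : ‖PowerSeries.coeff n
      (PowerSeries.C (ϖ : ℚ_[p]) * padicLFunction Dm.f (unitRoot W p : ℚ_[p]))‖ < (p : ℝ) ^ (0 : ℤ) := by
    rw [zpow_zero]; exact hlt
  have hle := (Padic.norm_lt_pow_iff_norm_le_pow_sub_one _ 0).mp h1
  rw [zero_sub] at hle
  rw [Nat.cast_zero, zero_add] at hn
  exact absurd (hn.trans_le hle) (lt_irrefl _)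

/-- **On the leaf, `μ_an = 0` forces every rational `p`-line to be unramified at `p` and even.**
Contrapositive of `not_analyticMuLE_zero_of_leaf_of_ramified_line`, plus type A (an unramified
rational line of a `¬ GVPar` curve is even, `lineEven_of_not_gvPar_of_unramified`).
[cite: GreenbergLNM1716, Prop. 5.7 (p. 113)] [cite: Wuthrich2014, Thm. 16 (p. 397)] -/
theorem forall_lineUnramifiedAt_and_lineEven_of_leaf_of_analyticMuLE_zero
    (h57 : prop57_one_le_mu_of_ramified_odd_line) (hW16 : Wuthrich2014.charIdeal_dvd_padicLFunction)
    (hmod : nonempty_modularParametrizationData) (hL : X1.RankZero.Leaf W p) (han : AnalyticMuLE W p 0) :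
    ∀ Φ : AddSubgroup (geomTorsion W (p : ℤ)), IsRationalLine W p Φ →
      LineUnramifiedAt W p Φ ∧ LineEven W p Φ := by
  intro Φ hΦ
  have hunr : LineUnramifiedAt W p Φ := by
    by_contra hram
    exact not_analyticMuLE_zero_of_leaf_of_ramified_line h57 hW16 hmod hL hΦ hram han
  exact ⟨hunr, lineEven_of_not_gvPar_of_unramified hL.not_gvPar hΦ hunr⟩

/-- **On the leaf, `μ_an = 0` puts the member OFF the barrier locus**: `AnalyticMuLE W p 0 →
¬ HasRamifiedOddLineAt W p` (granted Prop. 5.7, Thm. 16, modularity). So in a rank-`0` X1 class the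
members with a unit coefficient in `ϖ·L_p(f,α)` are among the off-locus members; the open stub
`stub_analyticMuZero_offLocus` is exactly the converse inclusion. [cite: GreenbergLNM1716, Prop. 5.7 (p. 113)]
[cite: Wuthrich2014, Thm. 16 (p. 397)] -/
theorem not_hasRamifiedOddLineAt_of_leaf_of_analyticMuLE_zero
    (h57 : prop57_one_le_mu_of_ramified_odd_line) (hW16 : Wuthrich2014.charIdeal_dvd_padicLFunction)
    (hmod : nonempty_modularParametrizationData) (hL : X1.RankZero.Leaf W p) (han : AnalyticMuLE W p 0) :
    ¬ HasRamifiedOddLineAt W p :=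
  EisensteinPrimesMazurMCOnX1RankZeroLocate.not_hasRamifiedOddLineAt_of_forall_lineUnramifiedAt
    fun Φ hΦ ↦ (forall_lineUnramifiedAt_and_lineEven_of_leaf_of_analyticMuLE_zero h57 hW16 hmod hL han Φ hΦ).1

/-- **The analytic μ-dichotomy of a leaf member** (granted Prop. 5.7, Thm. 16, modularity): EITHER
every rational `p`-line is unramified ∧ even (the member is the étale end of its class — there the
certificate `μ_an = 0` is Greenberg's conjecture, OPEN), OR the certificate `AnalyticMuLE W p 0` is
false. [cite: GreenbergLNM1716, Prop. 5.7 (p. 113) and Conj. 1.11 (p. 58)] [cite: Wuthrich2014, Thm. 16 (p. 397)] -/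
theorem analyticMu_dichotomy_of_leaf
    (h57 : prop57_one_le_mu_of_ramified_odd_line) (hW16 : Wuthrich2014.charIdeal_dvd_padicLFunction)
    (hmod : nonempty_modularParametrizationData) (hL : X1.RankZero.Leaf W p) :
    (∀ Φ : AddSubgroup (geomTorsion W (p : ℤ)), IsRationalLine W p Φ →
        LineUnramifiedAt W p Φ ∧ LineEven W p Φ) ∨ ¬ AnalyticMuLE W p 0 := by
  by_cases han : AnalyticMuLE W p 0
  · exact Or.inl (forall_lineUnramifiedAt_and_lineEven_of_leaf_of_analyticMuLE_zero h57 hW16 hmod hL han)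
  · exact Or.inr han

/-! ## §2 Why no hypothesis of Greenberg–Vatsal's (existential, one-line) shape can replace «off the locus» -/

omit hp in
/-- **Greenberg–Vatsal's Thm. (1.3) applies to NO member of a leaf isogeny class.** The leaf
(`ClassX1 ∧ r_an = 0`) is closed under `ℚ`-isogeny between globally minimal models
(`ClassX1.of_isIsogenous`, equal `L`-functions), and on it `GVPar` fails by definition of the class
(`¬(r = 0 ∧ gvpar)`); so the hypothesis of `thm13_charIdeal_eq_of_gvPar` / `prop510_…_of_gvPar`
is met by no `W′ ∼ W`. [cite: GreenbergVatsal2000, Thm. (1.3) (the parity hypothesis)] -/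
theorem not_gvPar_of_isIsogenous_of_leaf [Fact p.Prime] (hL : X1.RankZero.Leaf W p)
    {W' : WeierstrassCurve ℚ} [W'.IsElliptic] [W'.IsGloballyMinimal] (hiso : IsIsogenous W W') :
    X1.RankZero.Leaf W' p ∧ ¬ GVPar W' p := by
  have hX1' : ClassX1 W' p := ClassX1.of_isIsogenous hiso hL.classX1
  have hr0' : W'.analyticRank = 0 := by
    rw [← analyticRank_eq_of_isIsogenous' hiso]; exact hL.analyticRank_eq_zero
  exact ⟨⟨hX1', hr0'⟩, X1.RankZero.Leaf.not_gvPar ⟨hX1', hr0'⟩⟩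

/-- **The «fourth-cell» analogue of Thm. (1.3) in GV's existential shape is false on the leaf.** If a
leaf member carries a rational line `Φ` UNRAMIFIED at `p` (then even) together with a rational line `Ψ`
RAMIFIED at `p` (then odd) — `E[p]` split, e.g. `X_0(11)` at `5` with `ℤ/5 ⊕ μ_5` (Greenberg LNM 1716
§1, `μ = 1`) —, then the statement «some rational `p`-line is unramified ∧ even ⇒ `μ_an = 0`» fails at
that member (granted Prop. 5.7, Thm. 16, modularity). Hence an argument whose input is ONE rational
line of prescribed (ramification, parity) type — the shape of GV's proof of (1.3): the two characters
of `E[p]^{ss}`, Kato's divisibility, Ferrero–Washington on the admissible branch — cannot prove the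
stub: the stub's hypothesis is universal in the lines (`stub_iff_forall_lineUnramifiedAt_form`).
[cite: GreenbergLNM1716, §1 Conj. 1.11 and the X_0(11) example (p. 58), Prop. 5.7 (p. 113)]
[cite: GreenbergVatsal2000, Thm. (1.3)] [cite: Wuthrich2014, Thm. 16 (p. 397)] -/
theorem not_existsForm_of_leaf_of_unramified_of_ramified
    (h57 : prop57_one_le_mu_of_ramified_odd_line) (hW16 : Wuthrich2014.charIdeal_dvd_padicLFunction)
    (hmod : nonempty_modularParametrizationData) (hL : X1.RankZero.Leaf W p)
    {Φ Ψ : AddSubgroup (geomTorsion W (p : ℤ))} (hΦ : IsRationalLine W p Φ) (hΦu : LineUnramifiedAt W p Φ)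
    (hΨ : IsRationalLine W p Ψ) (hΨr : ¬ LineUnramifiedAt W p Ψ) :
    ¬ (∀ (V : WeierstrassCurve ℚ) [V.IsElliptic] [V.IsGloballyMinimal] (q : ℕ) [Fact q.Prime],
        X1.RankZero.Leaf V q →
        (∃ L : AddSubgroup (geomTorsion V (q : ℤ)), IsRationalLine V q L ∧
          LineUnramifiedAt V q L ∧ LineEven V q L) → AnalyticMuLE V q 0) := by
  intro hform
  have heven : LineEven W p Φ := lineEven_of_not_gvPar_of_unramified hL.not_gvPar hΦ hΦu
  exact not_analyticMuLE_zero_of_leaf_of_ramified_line h57 hW16 hmod hL hΨ hΨr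
    (hform W p hL ⟨Φ, hΦ, hΦu, heven⟩)

omit [W.IsElliptic] hp in
/-- **On the leaf, «off the barrier locus» = «every rational `p`-line is unramified»** (= «every
rational line unramified ∧ even», type A): the registered hypothesis `¬ HasRamifiedOddLineAt W₀ p` of
stubs 4–5 of line `mudescent` and the output «all lines unramified» of the landed `stub_locate`
(`exists_isIsogenous_forall_lineUnramifiedAt_of_good`) single out the same members.
[cite: GreenbergLNM1716, Prop. 5.7 (p. 113)] [cite: GreenbergVatsal2000, §2 p. 28] -/
theorem not_hasRamifiedOddLineAt_iff_forall_lineUnramifiedAt_of_leaf [Fact p.Prime]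
    (hL : X1.RankZero.Leaf W p) :
    ¬ HasRamifiedOddLineAt W p ↔
      ∀ Φ : AddSubgroup (geomTorsion W (p : ℤ)), IsRationalLine W p Φ → LineUnramifiedAt W p Φ := by
  refine ⟨fun hoff Φ hΦ ↦ ?_,
    EisensteinPrimesMazurMCOnX1RankZeroLocate.not_hasRamifiedOddLineAt_of_forall_lineUnramifiedAt⟩
  rcases lineType_of_not_gvPar hL.not_gvPar hΦ with ⟨hunr, -⟩ | ⟨hram, hodd⟩
  · exact hunr
  · exact absurd ⟨Φ, hΦ, hram, hodd⟩ hoff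

/-- **The registered stub and its universal-hypothesis form are the same statement.**
`stub_analyticMuZero_offLocus` (hypothesis `¬ HasRamifiedOddLineAt W₀ p`) ⟺ the same conclusion under
«every rational `p`-line of `W₀` is unramified» — bookkeeping between the skeleton's hypothesis and
`stub_locate`'s output; no content about `μ`. [cite: GreenbergLNM1716, Prop. 5.7 (p. 113)] -/
theorem stub_iff_forall_lineUnramifiedAt_form :
    (∀ (W₀ : WeierstrassCurve ℚ) [W₀.IsElliptic] [W₀.IsGloballyMinimal] (p : ℕ) [Fact p.Prime],
        ClassX1 W₀ p → W₀.analyticRank = 0 → ¬ HasRamifiedOddLineAt W₀ p → AnalyticMuLE W₀ p 0) ↔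
      ∀ (W₀ : WeierstrassCurve ℚ) [W₀.IsElliptic] [W₀.IsGloballyMinimal] (p : ℕ) [Fact p.Prime],
        ClassX1 W₀ p → W₀.analyticRank = 0 →
        (∀ Φ : AddSubgroup (geomTorsion W₀ (p : ℤ)), IsRationalLine W₀ p Φ → LineUnramifiedAt W₀ p Φ) →
          AnalyticMuLE W₀ p 0 := by
  refine ⟨fun h W₀ _ _ p _ hX1 hr0 hall ↦ h W₀ p hX1 hr0
      ((not_hasRamifiedOddLineAt_iff_forall_lineUnramifiedAt_of_leaf ⟨hX1, hr0⟩).mpr hall),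
    fun h W₀ _ _ p _ hX1 hr0 hoff ↦ h W₀ p hX1 hr0
      ((not_hasRamifiedOddLineAt_iff_forall_lineUnramifiedAt_of_leaf ⟨hX1, hr0⟩).mp hoff)⟩

/-! ## §3 Calibration: the stub is at least Greenberg's Conjecture 1.11 on the leaf (μ = 0 member located) -/

/-- **`μ(X(E/ℚ_∞)) = 0` at a leaf member with the certificate `μ_an = 0`** (leaf form of
`X1.MuPart.mu_eq_zero_of_analyticMuLE_zero`: Wuthrich Thm. 16 + modularity; Kato's direction alone).
Each census certificate `AnalyticMuLE W₀ p 0` at the `μ_an = 0` end of a class (iw-2: every class with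
`N < 2·10⁴` has one) is thereby a kernel instance of Greenberg's Conj. 1.11 for that class.
[cite: GreenbergLNM1716, Conj. 1.11 (p. 58)] [cite: Wuthrich2014, Thm. 16 (p. 397)] [cite: BCDTJAMS2001, Theorem A] -/
theorem mu_eq_zero_of_leaf_of_analyticMuLE_zero (hW16 : Wuthrich2014.charIdeal_dvd_padicLFunction)
    (hmod : nonempty_modularParametrizationData) (hL : X1.RankZero.Leaf W p) (han : AnalyticMuLE W p 0)
    {κ : ZpExtension ℚ p} {γ : Field.absoluteGaloisGroup ℚ}
    (hκ : κ.IsCyclotomic) (hγ : κ.IsTopGenerator γ) (hγ' : IsCyclotomicVariable p γ)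
    (D : W.SelmerDualData κ γ) : D.IsTorsion ∧ D.mu = 0 := by
  have hX := isClassX1_of_classX1 hL.classX1
  haveI : NeZero (W.conductorNorm ℤ) := ⟨(W.conductorNorm_pos_holds).ne'⟩
  refine ⟨(isTorsion_and_exists_factorisation hW16 hmod hX.two_ne hX.hasGoodReductionAtPrime
      hX.not_dvd_frobeniusTrace hX.not_hasIrreducibleModPGaloisRep hκ hγ hγ' D).1, ?_⟩
  exact mu_eq_zero_of_analyticMuLE_zero hW16 hmod hX.two_ne hX.hasGoodReductionAtPrime
    hX.not_dvd_frobeniusTrace hX.not_hasIrreducibleModPGaloisRep han hκ hγ hγ' D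

/-- **The stub implies Greenberg's Conjecture 1.11 on every rank-`0` X1 class, with the `μ = 0` member
located at the étale end.** Granted Wuthrich 2014 Thm. 16 (`hW16`) and modularity (`hmod`), IF
`stub_analyticMuZero_offLocus` holds (hypothesis `hstub`, verbatim the registered signature), then for
every globally minimal elliptic `W` and prime `p` with `ClassX1 W p`, `W.analyticRank = 0` there is a
globally minimal elliptic `W₀`, `ℚ`-isogenous to `W`, off the barrier locus, such that for the cyclotomic
`ℤ_p`-extension with any topological generator matching the cyclotomic variable, EVERY dual datum of
`Sel_{p^∞}(W₀/ℚ_∞)` is `Λ`-torsion with `μ = 0` — LNM 1716 Conj. 1.11 («there exists a ℚ-isogenous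
elliptic curve `E′` such that `μ_{E′} = 0`») for these `(E,p)`. DESCEND by `stub_locate` (p443510),
transport of the class and the rank along the isogeny, then `mu_eq_zero_of_leaf_of_analyticMuLE_zero`.
So the stub is not weaker than a conjecture OPEN in print on this locus (Ray 2023 §6: «expected … not
proved»; Trifković 2005 Conj. 2); the converse would need the main conjecture (the crux) and is not
claimed. [cite: GreenbergLNM1716, Conj. 1.11 (p. 58)] [cite: Wuthrich2014, Thm. 16 (p. 397)]
[cite: BCDTJAMS2001, Theorem A] -/
theorem greenbergMu_onLeaf_of_stub (hW16 : Wuthrich2014.charIdeal_dvd_padicLFunction)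
    (hmod : nonempty_modularParametrizationData)
    (hstub : ∀ (W₀ : WeierstrassCurve ℚ) [W₀.IsElliptic] [W₀.IsGloballyMinimal] (p : ℕ) [Fact p.Prime],
      ClassX1 W₀ p → W₀.analyticRank = 0 → ¬ HasRamifiedOddLineAt W₀ p → AnalyticMuLE W₀ p 0)
    (W : WeierstrassCurve ℚ) [W.IsElliptic] [W.IsGloballyMinimal] (p : ℕ) [Fact p.Prime]
    (hX1 : ClassX1 W p) (hr0 : W.analyticRank = 0) :
    ∃ (W₀ : WeierstrassCurve ℚ) (_ : W₀.IsElliptic) (_ : W₀.IsGloballyMinimal),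
      IsIsogenous W W₀ ∧ ¬ HasRamifiedOddLineAt W₀ p ∧
        ∀ (κ : ZpExtension ℚ p) (γ : Field.absoluteGaloisGroup ℚ),
          κ.IsCyclotomic → κ.IsTopGenerator γ → IsCyclotomicVariable p γ →
            ∀ D : W₀.SelmerDualData κ γ, D.IsTorsion ∧ D.mu = 0 := by
  obtain ⟨W₀, hE₀, hmin₀, hiso, hoff⟩ :=
    EisensteinPrimesMazurMCOnX1RankZeroLocate.stub_locate W p hX1 hr0
  have hX1₀ : ClassX1 W₀ p := ClassX1.of_isIsogenous hiso hX1
  have hr0₀ : W₀.analyticRank = 0 := by rw [← analyticRank_eq_of_isIsogenous' hiso]; exact hr0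
  have han : AnalyticMuLE W₀ p 0 := hstub W₀ p hX1₀ hr0₀ hoff
  exact ⟨W₀, hE₀, hmin₀, hiso, hoff, fun κ γ hκ hγ hγ' D ↦
    mu_eq_zero_of_leaf_of_analyticMuLE_zero hW16 hmod ⟨hX1₀, hr0₀⟩ han hκ hγ hγ' D⟩

end Summit.BirchSwinnertonDyer.BirchSwinnertonDyer.Theorems.EisensteinPrimesMazurMCOnX1RankZeroAnalyticMuOffLocus

end
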